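import Mathlib

/-!
# Lattice combinatorics of the classification of effective Casimir blocks, I: off-axis frequencies

Helper file for stub `stub_diagonalClassification` (S3b) of the line `farkas-split-menu` of crux
`MomentParity.CubicParityLoud`.  Abstract propagation on the punctured ball
`S = {k ∈ ℤ³ : k ≠ 0, |k|² ≤ N²}`: a predicate `G` ("the blocks at `±k` are classified") that
holds on the twelve frequencies of norm `2`, on `±eᵢ`, and PROPAGATES to `c = a + b` from two
non-parallel legs `a, b ∈ S` of unequal length, holds at every frequency with at least two
non-zero coordinates: write `k = (k − s eᵢ) + s eᵢ` with `s = sign kᵢ` and `|kᵢ| ≥ 2` (or any `i`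
on a body diagonal) — the first summand is shorter and again off-axis (strong induction on `|k|²`).
-/

namespace Summit.AnomalousDissipation.AnomalousDissipation.Theorems.MomentParityCubicParityLoud

open Matrix

set_option linter.dupNamespace false

set_option maxHeartbeats 800000 in
/-- **Off-axis propagation on the frequency ball.** [folklore] -/
theorem lattice_offaxis :
    ∀ (N : ℕ) (S : Finset (Fin 3 → ℤ)) (G : (Fin 3 → ℤ) → Prop), 3 ≤ N →
    (∀ k : Fin 3 → ℤ, k ∈ S ↔ k ≠ 0 ∧ k ⬝ᵥ k ≤ (N : ℤ) ^ 2) →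
    (∀ k ∈ S, k ⬝ᵥ k ≤ 2 → ((k 0 ≠ 0 ∧ k 1 ≠ 0) ∨ (k 0 ≠ 0 ∧ k 2 ≠ 0) ∨ (k 1 ≠ 0 ∧ k 2 ≠ 0)) → G k) →
    (∀ (i : Fin 3) (s : ℤ), (s = 1 ∨ s = -1) → G (Pi.single i s)) →
    (∀ a ∈ S, ∀ b ∈ S, ∀ c ∈ S, a + b = c → crossProduct a b ≠ 0 → a ⬝ᵥ a ≠ b ⬝ᵥ b → G a → G b → G c) →
    ∀ k ∈ S, ((k 0 ≠ 0 ∧ k 1 ≠ 0) ∨ (k 0 ≠ 0 ∧ k 2 ≠ 0) ∨ (k 1 ≠ 0 ∧ k 2 ≠ 0)) → G k := by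
  intro N S G hN hmem G2 GE Gprop
  have hN2 : (9 : ℤ) ≤ (N : ℤ) ^ 2 := by
    have : (3 : ℤ) ≤ (N : ℤ) := by exact_mod_cast hN
    nlinarith
  have memS : ∀ k : Fin 3 → ℤ, k ≠ 0 → k ⬝ᵥ k ≤ 9 → k ∈ S := fun k h0 h9 =>
    (hmem k).2 ⟨h0, h9.trans hN2⟩
  have normk : ∀ k : Fin 3 → ℤ, k ⬝ᵥ k = k 0 ^ 2 + k 1 ^ 2 + k 2 ^ 2 := fun k => by
    rw [vec3_dotProduct]; ring
  have sq1 : ∀ x : ℤ, x ≠ 0 → 1 ≤ x ^ 2 := fun x hx => by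
    have : 0 < x ^ 2 := by positivity
    omega
  have claimA : ∀ n : ℕ, ∀ k ∈ S, k ⬝ᵥ k ≤ (n : ℤ) →
      ((k 0 ≠ 0 ∧ k 1 ≠ 0) ∨ (k 0 ≠ 0 ∧ k 2 ≠ 0) ∨ (k 1 ≠ 0 ∧ k 2 ≠ 0)) → G k := by
    intro n
    induction n using Nat.strong_induction_on with
    | _ n IH => ?_
    have step0 : ∀ (k : Fin 3 → ℤ) (s : ℤ), k ∈ S → k ⬝ᵥ k ≤ (n : ℤ) → (s = 1 ∨ s = -1) → 0 < s * k 0 →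
        (k 1 ≠ 0 ∨ k 2 ≠ 0) → (k 0 - s ≠ 0 ∨ (k 1 ≠ 0 ∧ k 2 ≠ 0)) → G k := by
      intro k s hk hkn hs hpos hjk hna'
      have hs2 : s * s = 1 := by rcases hs with rfl | rfl <;> norm_num
      have hs0 : s ≠ 0 := by rcases hs with rfl | rfl <;> norm_num
      obtain ⟨a, ha⟩ : ∃ a : Fin 3 → ℤ, a = ![k 0 - s, k 1, k 2] := ⟨_, rfl⟩
      obtain ⟨b, hb⟩ : ∃ b : Fin 3 → ℤ, b = ![s, 0, 0] := ⟨_, rfl⟩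
      have hab : a + b = k := by
        rw [ha, hb]; ext i; fin_cases i <;> simp
      have Gb : G b := by
        have e : b = Pi.single 0 s := by rw [hb]; ext i; fin_cases i <;> simp
        rw [e]; exact GE 0 s hs
      have ea0 : a 0 = k 0 - s := by rw [ha]; simp
      have ea1 : a 1 = k 1 := by rw [ha]; simp
      have ea2 : a 2 = k 2 := by rw [ha]; simp
      have hna_a : (a 0 ≠ 0 ∧ a 1 ≠ 0) ∨ (a 0 ≠ 0 ∧ a 2 ≠ 0) ∨ (a 1 ≠ 0 ∧ a 2 ≠ 0) := by
        rw [ea0, ea1, ea2]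
        rcases hna' with h0 | ⟨h1, h2⟩
        · rcases hjk with h1 | h2
          · exact Or.inl ⟨h0, h1⟩
          · exact Or.inr (Or.inl ⟨h0, h2⟩)
        · exact Or.inr (Or.inr ⟨h1, h2⟩)
      have ha0 : a ≠ 0 := by
        intro h
        rcases hna_a with ⟨h1, -⟩ | ⟨h1, -⟩ | ⟨h1, -⟩ <;> exact h1 (by rw [h]; rfl)
      have hnorm_a : a ⬝ᵥ a = k ⬝ᵥ k - 2 * (s * k 0) + 1 := by
        rw [normk, normk k, ea0, ea1, ea2]; linear_combination hs2
      have hkk : k ⬝ᵥ k ≤ (N : ℤ) ^ 2 := ((hmem k).1 hk).2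
      have ha_mem : a ∈ S := (hmem a).2 ⟨ha0, by rw [hnorm_a]; linarith⟩
      have hbb : b ⬝ᵥ b = 1 := by
        rw [normk, hb]
        simp only [Fin.isValue, Matrix.cons_val_zero, Matrix.cons_val_one, Matrix.cons_val_two, Matrix.head_cons,
          Matrix.tail_cons]
        linear_combination hs2
      have hb0 : b ≠ 0 := by
        intro h; have h' := congrFun h 0; rw [hb] at h'; simp at h'; exact hs0 h'
      have hb_mem : b ∈ S := memS b hb0 (by rw [hbb]; norm_num)
      have haa2 : 2 ≤ a ⬝ᵥ a := by
        rw [normk]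
        rcases hna_a with ⟨h1, h2⟩ | ⟨h1, h2⟩ | ⟨h1, h2⟩ <;>
          nlinarith [sq1 _ h1, sq1 _ h2, sq_nonneg (a 0), sq_nonneg (a 1), sq_nonneg (a 2)]
      have hne : a ⬝ᵥ a ≠ b ⬝ᵥ b := by rw [hbb]; omega
      have hcross : crossProduct a b ≠ 0 := by
        intro h
        have h1 := congrFun h 1
        have h2 := congrFun h 2
        rw [ha, hb] at h1 h2
        simp only [cross_apply, Fin.isValue, cons_val_zero, cons_val_one, cons_val_two, head_cons, tail_cons,
          Pi.zero_apply, mul_zero, sub_zero, zero_sub, neg_eq_zero, mul_eq_zero, Nat.succ_eq_add_one,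
          Nat.reduceAdd] at h1 h2
        rcases hjk with h' | h'
        · rcases h2 with h'' | h'' <;> [exact h' h''; exact hs0 h'']
        · rcases h1 with h'' | h'' <;> [exact h' h''; exact hs0 h'']
      have hn1 : ((n - 1 : ℕ) : ℤ) = (n : ℤ) - 1 := by
        have h9 : 1 ≤ k ⬝ᵥ k := by
          rw [normk]
          rcases hjk with h' | h' <;> nlinarith [sq1 _ h', sq_nonneg (k 0), sq_nonneg (k 1), sq_nonneg (k 2)]
        have : (1 : ℤ) ≤ n := h9.trans hkn
        have : 1 ≤ n := by exact_mod_cast this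
        omega
      have Ga : G a := IH (n - 1) (by omega) a ha_mem (by rw [hn1, hnorm_a]; linarith) hna_a
      exact Gprop a ha_mem b hb_mem k hk hab hcross hne Ga Gb
    have step1 : ∀ (k : Fin 3 → ℤ) (s : ℤ), k ∈ S → k ⬝ᵥ k ≤ (n : ℤ) → (s = 1 ∨ s = -1) → 0 < s * k 1 →
        (k 0 ≠ 0 ∨ k 2 ≠ 0) → (k 1 - s ≠ 0 ∨ (k 0 ≠ 0 ∧ k 2 ≠ 0)) → G k := by
      intro k s hk hkn hs hpos hjk hna'
      have hs2 : s * s = 1 := by rcases hs with rfl | rfl <;> norm_num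
      have hs0 : s ≠ 0 := by rcases hs with rfl | rfl <;> norm_num
      obtain ⟨a, ha⟩ : ∃ a : Fin 3 → ℤ, a = ![k 0, k 1 - s, k 2] := ⟨_, rfl⟩
      obtain ⟨b, hb⟩ : ∃ b : Fin 3 → ℤ, b = ![0, s, 0] := ⟨_, rfl⟩
      have hab : a + b = k := by
        rw [ha, hb]; ext i; fin_cases i <;> simp
      have Gb : G b := by
        have e : b = Pi.single 1 s := by rw [hb]; ext i; fin_cases i <;> simp
        rw [e]; exact GE 1 s hs
      have ea0 : a 1 = k 1 - s := by rw [ha]; simp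
      have ea1 : a 0 = k 0 := by rw [ha]; simp
      have ea2 : a 2 = k 2 := by rw [ha]; simp
      have hna_a : (a 0 ≠ 0 ∧ a 1 ≠ 0) ∨ (a 0 ≠ 0 ∧ a 2 ≠ 0) ∨ (a 1 ≠ 0 ∧ a 2 ≠ 0) := by
        rw [ea0, ea1, ea2]
        rcases hna' with h0 | ⟨h1, h2⟩
        · rcases hjk with h1 | h2
          · exact Or.inl ⟨h1, h0⟩
          · exact Or.inr (Or.inr ⟨h0, h2⟩)
        · exact Or.inr (Or.inl ⟨h1, h2⟩)
      have ha0 : a ≠ 0 := by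
        intro h
        rcases hna_a with ⟨h1, -⟩ | ⟨h1, -⟩ | ⟨h1, -⟩ <;> exact h1 (by rw [h]; rfl)
      have hnorm_a : a ⬝ᵥ a = k ⬝ᵥ k - 2 * (s * k 1) + 1 := by
        rw [normk, normk k, ea0, ea1, ea2]; linear_combination hs2
      have hkk : k ⬝ᵥ k ≤ (N : ℤ) ^ 2 := ((hmem k).1 hk).2
      have ha_mem : a ∈ S := (hmem a).2 ⟨ha0, by rw [hnorm_a]; linarith⟩
      have hbb : b ⬝ᵥ b = 1 := by
        rw [normk, hb]
        simp only [Fin.isValue, Matrix.cons_val_zero, Matrix.cons_val_one, Matrix.cons_val_two, Matrix.head_cons,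
          Matrix.tail_cons]
        linear_combination hs2
      have hb0 : b ≠ 0 := by
        intro h; have h' := congrFun h 1; rw [hb] at h'; simp at h'; exact hs0 h'
      have hb_mem : b ∈ S := memS b hb0 (by rw [hbb]; norm_num)
      have haa2 : 2 ≤ a ⬝ᵥ a := by
        rw [normk]
        rcases hna_a with ⟨h1, h2⟩ | ⟨h1, h2⟩ | ⟨h1, h2⟩ <;>
          nlinarith [sq1 _ h1, sq1 _ h2, sq_nonneg (a 0), sq_nonneg (a 1), sq_nonneg (a 2)]
      have hne : a ⬝ᵥ a ≠ b ⬝ᵥ b := by rw [hbb]; omega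
      have hcross : crossProduct a b ≠ 0 := by
        intro h
        have h1 := congrFun h 0
        have h2 := congrFun h 2
        rw [ha, hb] at h1 h2
        simp only [cross_apply, Fin.isValue, cons_val_zero, cons_val_one, cons_val_two, head_cons, tail_cons,
          Pi.zero_apply, mul_zero, sub_zero, zero_sub, neg_eq_zero, mul_eq_zero, Nat.succ_eq_add_one,
          Nat.reduceAdd] at h1 h2
        rcases hjk with h' | h'
        · rcases h2 with h'' | h'' <;> [exact h' h''; exact hs0 h'']
        · rcases h1 with h'' | h'' <;> [exact h' h''; exact hs0 h'']
      have hn1 : ((n - 1 : ℕ) : ℤ) = (n : ℤ) - 1 := by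
        have h9 : 1 ≤ k ⬝ᵥ k := by
          rw [normk]
          rcases hjk with h' | h' <;> nlinarith [sq1 _ h', sq_nonneg (k 0), sq_nonneg (k 1), sq_nonneg (k 2)]
        have : (1 : ℤ) ≤ n := h9.trans hkn
        have : 1 ≤ n := by exact_mod_cast this
        omega
      have Ga : G a := IH (n - 1) (by omega) a ha_mem (by rw [hn1, hnorm_a]; linarith) hna_a
      exact Gprop a ha_mem b hb_mem k hk hab hcross hne Ga Gb
    have step2 : ∀ (k : Fin 3 → ℤ) (s : ℤ), k ∈ S → k ⬝ᵥ k ≤ (n : ℤ) → (s = 1 ∨ s = -1) → 0 < s * k 2 →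
        (k 0 ≠ 0 ∨ k 1 ≠ 0) → (k 2 - s ≠ 0 ∨ (k 0 ≠ 0 ∧ k 1 ≠ 0)) → G k := by
      intro k s hk hkn hs hpos hjk hna'
      have hs2 : s * s = 1 := by rcases hs with rfl | rfl <;> norm_num
      have hs0 : s ≠ 0 := by rcases hs with rfl | rfl <;> norm_num
      obtain ⟨a, ha⟩ : ∃ a : Fin 3 → ℤ, a = ![k 0, k 1, k 2 - s] := ⟨_, rfl⟩
      obtain ⟨b, hb⟩ : ∃ b : Fin 3 → ℤ, b = ![0, 0, s] := ⟨_, rfl⟩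
      have hab : a + b = k := by
        rw [ha, hb]; ext i; fin_cases i <;> simp
      have Gb : G b := by
        have e : b = Pi.single 2 s := by rw [hb]; ext i; fin_cases i <;> simp
        rw [e]; exact GE 2 s hs
      have ea0 : a 2 = k 2 - s := by rw [ha]; simp
      have ea1 : a 0 = k 0 := by rw [ha]; simp
      have ea2 : a 1 = k 1 := by rw [ha]; simp
      have hna_a : (a 0 ≠ 0 ∧ a 1 ≠ 0) ∨ (a 0 ≠ 0 ∧ a 2 ≠ 0) ∨ (a 1 ≠ 0 ∧ a 2 ≠ 0) := by
        rw [ea0, ea1, ea2]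
        rcases hna' with h0 | ⟨h1, h2⟩
        · rcases hjk with h1 | h2
          · exact Or.inr (Or.inl ⟨h1, h0⟩)
          · exact Or.inr (Or.inr ⟨h2, h0⟩)
        · exact Or.inl ⟨h1, h2⟩
      have ha0 : a ≠ 0 := by
        intro h
        rcases hna_a with ⟨h1, -⟩ | ⟨h1, -⟩ | ⟨h1, -⟩ <;> exact h1 (by rw [h]; rfl)
      have hnorm_a : a ⬝ᵥ a = k ⬝ᵥ k - 2 * (s * k 2) + 1 := by
        rw [normk, normk k, ea0, ea1, ea2]; linear_combination hs2
      have hkk : k ⬝ᵥ k ≤ (N : ℤ) ^ 2 := ((hmem k).1 hk).2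
      have ha_mem : a ∈ S := (hmem a).2 ⟨ha0, by rw [hnorm_a]; linarith⟩
      have hbb : b ⬝ᵥ b = 1 := by
        rw [normk, hb]
        simp only [Fin.isValue, Matrix.cons_val_zero, Matrix.cons_val_one, Matrix.cons_val_two, Matrix.head_cons,
          Matrix.tail_cons]
        linear_combination hs2
      have hb0 : b ≠ 0 := by
        intro h; have h' := congrFun h 2; rw [hb] at h'; simp at h'; exact hs0 h'
      have hb_mem : b ∈ S := memS b hb0 (by rw [hbb]; norm_num)
      have haa2 : 2 ≤ a ⬝ᵥ a := by
        rw [normk]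
        rcases hna_a with ⟨h1, h2⟩ | ⟨h1, h2⟩ | ⟨h1, h2⟩ <;>
          nlinarith [sq1 _ h1, sq1 _ h2, sq_nonneg (a 0), sq_nonneg (a 1), sq_nonneg (a 2)]
      have hne : a ⬝ᵥ a ≠ b ⬝ᵥ b := by rw [hbb]; omega
      have hcross : crossProduct a b ≠ 0 := by
        intro h
        have h1 := congrFun h 0
        have h2 := congrFun h 1
        rw [ha, hb] at h1 h2
        simp only [cross_apply, Fin.isValue, cons_val_zero, cons_val_one, cons_val_two, head_cons, tail_cons,
          Pi.zero_apply, mul_zero, sub_zero, zero_sub, neg_eq_zero, mul_eq_zero, Nat.succ_eq_add_one,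
          Nat.reduceAdd] at h1 h2
        rcases hjk with h' | h'
        · rcases h2 with h'' | h'' <;> [exact h' h''; exact hs0 h'']
        · rcases h1 with h'' | h'' <;> [exact h' h''; exact hs0 h'']
      have hn1 : ((n - 1 : ℕ) : ℤ) = (n : ℤ) - 1 := by
        have h9 : 1 ≤ k ⬝ᵥ k := by
          rw [normk]
          rcases hjk with h' | h' <;> nlinarith [sq1 _ h', sq_nonneg (k 0), sq_nonneg (k 1), sq_nonneg (k 2)]
        have : (1 : ℤ) ≤ n := h9.trans hkn
        have : 1 ≤ n := by exact_mod_cast this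
        omega
      have Ga : G a := IH (n - 1) (by omega) a ha_mem (by rw [hn1, hnorm_a]; linarith) hna_a
      exact Gprop a ha_mem b hb_mem k hk hab hcross hne Ga Gb
    intro k hk hkn hna
    by_cases h2 : k ⬝ᵥ k ≤ 2
    · exact G2 k hk h2 hna
    have sgn : ∀ x : ℤ, x ≠ 0 → ∃ s : ℤ, (s = 1 ∨ s = -1) ∧ 0 < s * x := fun x hx => by
      rcases lt_or_gt_of_ne hx with h | h
      · exact ⟨-1, Or.inr rfl, by linarith⟩
      · exact ⟨1, Or.inl rfl, by linarith⟩
    have habs : ∀ (x s : ℤ), (s = 1 ∨ s = -1) → 0 < s * x → 2 ≤ |x| → x - s ≠ 0 := by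
      intro x s hs hsx hx h
      have : x = s := by linarith
      subst this
      rcases hs with rfl | rfl <;> norm_num at hx
    by_cases hbig : ∃ i, 2 ≤ |k i|
    · obtain ⟨i, hi⟩ := hbig
      fin_cases i
      · have hk0 : k 0 ≠ 0 := by intro h; simp [h] at hi
        obtain ⟨s, hs, hpos⟩ := sgn _ hk0
        refine step0 k s hk hkn hs hpos ?_ (Or.inl (habs _ _ hs hpos hi))
        rcases hna with ⟨-, h⟩ | ⟨-, h⟩ | ⟨h, -⟩ <;> [exact Or.inl h; exact Or.inr h; exact Or.inl h]
      · have hk0 : k 1 ≠ 0 := by intro h; simp [h] at hi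
        obtain ⟨s, hs, hpos⟩ := sgn _ hk0
        refine step1 k s hk hkn hs hpos ?_ (Or.inl (habs _ _ hs hpos hi))
        rcases hna with ⟨h, -⟩ | ⟨h, -⟩ | ⟨-, h⟩ <;> [exact Or.inl h; exact Or.inl h; exact Or.inr h]
      · have hk0 : k 2 ≠ 0 := by intro h; simp [h] at hi
        obtain ⟨s, hs, hpos⟩ := sgn _ hk0
        refine step2 k s hk hkn hs hpos ?_ (Or.inl (habs _ _ hs hpos hi))
        rcases hna with ⟨h, -⟩ | ⟨h, -⟩ | ⟨h, -⟩ <;> [exact Or.inl h; exact Or.inl h; exact Or.inr h]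
    · push Not at hbig
      have hb : ∀ i, k i ^ 2 ≤ 1 := fun i => by
        have h1 : |k i| ≤ 1 := by have := hbig i; omega
        nlinarith [abs_mul_abs_self (k i), abs_nonneg (k i)]
      have hall : k 0 ≠ 0 ∧ k 1 ≠ 0 ∧ k 2 ≠ 0 := by
        rw [normk] at h2
        refine ⟨?_, ?_, ?_⟩ <;> intro h <;> rw [h] at h2 <;> nlinarith [hb 0, hb 1, hb 2]
      obtain ⟨s, hs, hpos⟩ := sgn _ hall.1
      exact step0 k s hk hkn hs hpos (Or.inl hall.2.1) (Or.inr ⟨hall.2.1, hall.2.2⟩)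
  intro k hk hna
  exact claimA (Int.toNat (k ⬝ᵥ k)) k hk (Int.self_le_toNat _) hna

end Summit.AnomalousDissipation.AnomalousDissipation.Theorems.MomentParityCubicParityLoud
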